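import Mathlib
import Summits.NavierStokesRegularity.NavierStokesRegularity.Theorems.EulerZoomLiouvillePowerGaugeEulerLiouvilleSelfSimilarHighSetFluxTools
import HarnessLib

/-!
# «JETS MUST TURN» — THE TURNING LAW: the similarity inflow flux of a Bernoulli high set through every sphere layer is matched by outflow flux
# (crux `EulerZoomLiouville.PowerGaugeEulerLiouville` = stmt-NavierStokesRegularity-19832, THE ONE STATEMENT `stub_selfSimilarC2Needle`, T2 face;
#  line `needle_faces` stub B `stub_pressureFace` (ns-idea-11 g7) «flux law Q_in ≤ Q_out + 3γ·vol(high ∩ far)»; width seat ns-ezl-w1 g5)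

Route №10 `EulerZoomLiouville` (NavierStokesRegularity).  Assembly of the tools of `…SelfSimilarHighSetFluxTools` (flux identity, exit law, outer-flux
bound).  `(U, P)` a `C²` self-similar Euler profile on `ℝ³` (centre `0`), `W = γy + U` (`div W = 3γ`), `θ_{R,r}` the Tao cutoff of the layer
`R(R−r) ≤ |x|² ≤ R²`, `F_{R,r}(ω) = ∫ ω · (−Dθ_{R,r}[W]) = ∫ ω k ⟪x, W⟫` (`k = (2/(rR)) S′ ≥ 0`, `flux_integrand_eq`) the smeared OUTWARD radial
`W`-flux of the `ω`-set through the layer.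

* **`flux_turning_law`** — THE TURNING LAW: for `γ ≥ 0`, the `A`-growth `∫_{B̄_L}|U|² ≤ c_A L^{θ_A}` (`L ≥ 1`, `θ_A < 2`), `ω ∈ C¹`, `0 ≤ ω ≤ 1`
  non-increasing along `W`, and a far `ω`-set `{ω ≠ 0} ∩ {R(R−r) ≤ |x|²}` of finite volume:
  `F_{R,r}(ω) ≥ −3γ · vol({ω ≠ 0} ∩ {R(R−r) ≤ |x|²})`.
  Proof: exit law between the layer and the fat outer layer `θ_{n,n/2}`; the outer flux is `≤ 4M(vol_n/2 + γ² vol_n + c_A n^{θ_A−2}) → 0`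
  (`abs_flux_le`; tails of the finite far volume, `tendsto_volume_inter_far_zero`; the `ω`-mass in between is `≤ vol(far ω-set)`,
  `integral_mul_sub_taoCutoff_le`).
* **`bernoulli_flux_turning_law`** — the instance `ω = S((ℋ_P − h)/η)` (`0 ≤ γ ≤ ½`, `η > 0`; `contDiff_bernoulliWeight`,
  `fderiv_bernoulliWeight_transport_nonpos` = CIV (3.33), `{ω ≠ 0} ⊆ {ℋ > h}`, `ω = 1` on `{ℋ ≥ h + η}`): for every level whose far high set has finite
  volume, `∫ S((ℋ−h)/η) k ⟪x, W⟫ ≥ −3γ · vol({ℋ_P > h} ∩ {R(R−r) ≤ |x|²})` — for class profiles the right side is `≥ −C (R(R−r))^{−(3+3ρ)/2}` by the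
  growth-free Sobolev thinness of high sets (ns-ezl-w5 `Loc.volume_bernoulliHigh_inter_far_le_sobolev_free`), and the `A`-growth is the class datum
  (`setIntegral_closedBall_sq_norm_le_of_gauge`, `θ_A = 1 − 2ρ`).

READING FOR THE NEEDLE (RESIDUE-MEMO-19832-g12 §1/§7): the sign of a point's contribution is the sign of `⟪x, W x⟫ = (γ − s)|x|²` (`s` the similarity
inflow rate).  The fast vortical Bernoulli-high INFLOW points of a channel (`⟪y, W y⟫ ≤ −c₁‖y‖²`) carry flux `≤ −c₁R²·k` per unit volume of the
layer; the law forces, ON THE SAME SPHERE LAYER and INSIDE THE SAME (smoothed) HIGH SET, outflow points (`s < γ`: tangential, pressurised or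
radially outgoing high points — the «turning heads» of line `needle_faces`) of matching weighted flux, up to `3γ·vol(high ∩ far) ≲ R^{−3−3ρ}`.
Marginal stagnant points (`W ≈ 0`) carry no flux: the law constrains the jets that FEED the high set, not the parked cells; it is the ideator's
«Q_in(r) ≤ Q_out(r) + 3γ·vol(high ∩ {|y| > r})» typed, and the Eulerian twin of the Lagrangian volume law `vol(Φ_{−t}A) = e^{−3γt}vol A`.

HONEST LABEL: tool (global bookkeeping inequality) for the T2 face / stub B; nothing here excludes a needle.  WHAT THIS IS NOT: not NS, not E —
`--supports` stmt-19832 on the MODEL lattice; 19832 OPEN; NS regularity NOT proved. [folklore; ConstantinIgnatovaVicol2026Putative §3.4.1 (3.22),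
§3.4.3 (3.33); Leray1934 §6 (1.11); Tao2011 §8 (58)]
-/

noncomputable section

-- flat `Theorems/<Route><Decl>…` files of one crux share the namespace of the crux (tree convention)
set_option linter.dupNamespace false

open MeasureTheory Set Filter Topology Metric Function InnerProductSpace
open scoped RealInnerProductSpace NNReal ENNReal

namespace Summit.NavierStokesRegularity.NavierStokesRegularity.Theorems.PowerGaugeEulerLiouville.HighSetFlux

open Literature.Analysis Literature.Analysis.FluidPDE

/-! ### The turning law -/

section Turning

variable {γ : ℝ} {U : EuclideanSpace ℝ (Fin 3) → EuclideanSpace ℝ (Fin 3)} {P : EuclideanSpace ℝ (Fin 3) → ℝ}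

/-- The `ω`-mass between two nested layers is at most the volume of the far `ω`-set:
`∫ ω (θ_{R₂,r₂} − θ_{R,r}) ≤ vol({ω ≠ 0} ∩ {R(R−r) ≤ |x|²})` for `0 ≤ ω ≤ 1` (the integrand vanishes on the core `|x|² < R(R−r)` where
`θ_{R,r} = 1 ≥ θ_{R₂,r₂}`). [folklore] -/
theorem integral_mul_sub_taoCutoff_le {ω : EuclideanSpace ℝ (Fin 3) → ℝ} (hωc : Continuous ω) (hω0 : ∀ x, 0 ≤ ω x)
    (hω1 : ∀ x, ω x ≤ 1) {R r R₂ r₂ : ℝ} (hr : 0 < r) (hrR : r ≤ R) (hr₂ : 0 < r₂) (hr₂R : r₂ ≤ R₂)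
    (hfin : volume ({x : EuclideanSpace ℝ (Fin 3) | ω x ≠ 0} ∩ {x | R * (R - r) ≤ ‖x‖ ^ 2}) < ∞) :
    (∫ x, ω x * (taoCutoff R₂ r₂ x - taoCutoff R r x)) ≤
      (volume ({x : EuclideanSpace ℝ (Fin 3) | ω x ≠ 0} ∩ {x | R * (R - r) ≤ ‖x‖ ^ 2})).toReal := by
  set S : Set (EuclideanSpace ℝ (Fin 3)) := {x | ω x ≠ 0} ∩ {x | R * (R - r) ≤ ‖x‖ ^ 2} with hSdef
  have hR : 0 < R := hr.trans_le hrR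
  have hR₂ : 0 < R₂ := hr₂.trans_le hr₂R
  have hSm : MeasurableSet S :=
    (isOpen_ne_fun hωc continuous_const).measurableSet.inter (isClosed_le continuous_const (continuous_norm.pow 2)).measurableSet
  have hpt : ∀ x, ω x * (taoCutoff R₂ r₂ x - taoCutoff R r x) ≤ S.indicator (fun _ => (1 : ℝ)) x := by
    intro x
    by_cases hx : x ∈ S
    · rw [indicator_of_mem hx]
      have h1 : taoCutoff R₂ r₂ x - taoCutoff R r x ≤ 1 := by
        linarith [taoCutoff_le_one R₂ r₂ x, taoCutoff_nonneg R r x]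
      calc ω x * (taoCutoff R₂ r₂ x - taoCutoff R r x) ≤ ω x * 1 := mul_le_mul_of_nonneg_left h1 (hω0 x)
        _ ≤ 1 := by rw [mul_one]; exact hω1 x
    · rw [indicator_of_notMem hx]
      simp only [hSdef, mem_inter_iff, mem_setOf_eq, not_and_or, not_not, not_le] at hx
      rcases hx with hx | hx
      · rw [hx, zero_mul]
      · have h1 : taoCutoff R r x = 1 := taoCutoff_eq_one hR hr hx.le
        rw [h1]
        exact mul_nonpos_of_nonneg_of_nonpos (hω0 x) (by linarith [taoCutoff_le_one R₂ r₂ x])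
  have hτc : Continuous fun x => ω x * (taoCutoff R₂ r₂ x - taoCutoff R r x) :=
    hωc.mul ((continuous_taoCutoff R₂ r₂).sub (continuous_taoCutoff R r))
  have hτi : Integrable fun x => ω x * (taoCutoff R₂ r₂ x - taoCutoff R r x) := by
    refine hτc.integrable_of_hasCompactSupport
      (HasCompactSupport.of_support_subset_isCompact (isCompact_closedBall (0 : EuclideanSpace ℝ (Fin 3)) (max R R₂))
        fun x hx => ?_)
    rw [mem_closedBall, dist_zero_right]
    by_contra hxR
    refine hx ?_
    have h2 : max R R₂ < ‖x‖ := not_le.1 hxR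
    simp only [taoCutoff_eq_zero hR₂.le hr₂.le ((le_max_right _ _).trans h2.le),
      taoCutoff_eq_zero hR.le hr.le ((le_max_left _ _).trans h2.le), sub_zero, mul_zero]
  have hind : Integrable (S.indicator fun _ => (1 : ℝ)) :=
    ((integrableOn_const_iff (C := (1 : ℝ))).2 (Or.inr hfin)).integrable_indicator hSm
  calc (∫ x, ω x * (taoCutoff R₂ r₂ x - taoCutoff R r x)) ≤ ∫ x, S.indicator (fun _ => (1 : ℝ)) x :=
        integral_mono hτi hind hpt
    _ = (volume S).toReal := by
        rw [integral_indicator hSm, setIntegral_const, smul_eq_mul, mul_one, measureReal_def]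

/-- Tails of a finite-volume set: `vol(S ∩ {n²/2 ≤ |x|²}) → 0` as `n → ∞`. [folklore] -/
theorem tendsto_volume_inter_far_zero {S : Set (EuclideanSpace ℝ (Fin 3))} (hSm : MeasurableSet S) (hfin : volume S < ∞) :
    Tendsto (fun n : ℕ => (volume (S ∩ {x : EuclideanSpace ℝ (Fin 3) | (n : ℝ) ^ 2 / 2 ≤ ‖x‖ ^ 2})).toReal) atTop (𝓝 0) := by
  set T : ℕ → Set (EuclideanSpace ℝ (Fin 3)) := fun n => S ∩ {x | (n : ℝ) ^ 2 / 2 ≤ ‖x‖ ^ 2} with hTdef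
  have hTm : ∀ n, NullMeasurableSet (T n) volume := fun n =>
    (hSm.inter (isClosed_le continuous_const (continuous_norm.pow 2)).measurableSet).nullMeasurableSet
  have hanti : Antitone T := by
    intro m n hmn x hx
    refine ⟨hx.1, ?_⟩
    have h1 : ((m : ℝ)) ^ 2 / 2 ≤ (n : ℝ) ^ 2 / 2 := by
      have : (m : ℝ) ≤ n := Nat.cast_le.2 hmn
      have hm0 : (0 : ℝ) ≤ m := Nat.cast_nonneg m
      nlinarith
    exact h1.trans hx.2
  have hempty : (⋂ n, T n) = ∅ := by
    refine eq_empty_iff_forall_notMem.2 fun x hx => ?_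
    rw [mem_iInter] at hx
    obtain ⟨n, hn⟩ := exists_nat_gt (2 * ‖x‖ + 2)
    have h : (n : ℝ) ^ 2 / 2 ≤ ‖x‖ ^ 2 := (hx n).2
    have hx0 : 0 ≤ ‖x‖ := norm_nonneg x
    have hsq : (2 * ‖x‖ + 2) ^ 2 < (n : ℝ) ^ 2 := by
      have h0 : 0 ≤ 2 * ‖x‖ + 2 := by positivity
      nlinarith
    nlinarith
  have hlim := tendsto_measure_iInter_atTop hTm hanti ⟨0, ((measure_mono inter_subset_left).trans_lt hfin).ne⟩
  rw [hempty, measure_empty] at hlim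
  have h2 := (ENNReal.tendsto_toReal ENNReal.zero_ne_top).comp hlim
  rw [ENNReal.toReal_zero] at h2
  exact h2

/-- **THE TURNING LAW («JETS MUST TURN»).**  Let `(U, P)` be a `C²` self-similar Euler profile on `ℝ³` (centre `0`, exponent `γ ≥ 0`) with the
`A`-growth `∫_{B̄_L} ‖U‖² ≤ c_A L^{θ_A}` (`L ≥ 1`, `θ_A < 2`; the class profiles have `θ_A = 1 − 2ρ`), and let `ω ∈ C¹`, `0 ≤ ω ≤ 1`, be non-increasing
along `W = γy + U` (`Dω[W] ≤ 0`).  If the far `ω`-set `{ω ≠ 0} ∩ {R(R−r) ≤ |x|²}` has finite volume (`0 < r ≤ R`), then the smeared outward radial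
`W`-flux of the `ω`-set through the layer `R(R−r) ≤ |x|² ≤ R²` is bounded BELOW:

  `F_{R,r}(ω) = ∫ ω · (−Dθ_{R,r}[W]) ≥ −3γ · vol({ω ≠ 0} ∩ {R(R−r) ≤ |x|²})`.

Proof: exit law between the layer and the fat outer layer `θ_{n,n/2}`, `n → ∞`; the outer flux is `≤ 4M(vol_n/2 + γ² vol_n + c_A n^{θ_A−2}) → 0`
(`abs_flux_le`, tails of the finite far volume).  Reading: the `ω`-weighted INFLOW flux (`⟪x, W⟫ < 0`) through every sphere layer is matched by
OUTFLOW flux (`⟪x, W⟫ > 0`) up to `3γ ×` the far `ω`-volume. [folklore; ConstantinIgnatovaVicol2026Putative §3.4.1 (3.22)] -/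
theorem flux_turning_law (hprof : IsSelfSimilarEulerProfile γ 0 U P) (hγ : 0 ≤ γ)
    {ω : EuclideanSpace ℝ (Fin 3) → ℝ} (hω : ContDiff ℝ 1 ω) (hω0 : ∀ x, 0 ≤ ω x) (hω1 : ∀ x, ω x ≤ 1)
    (hanti : ∀ x, fderiv ℝ ω x (selfSimilarTransport γ 0 U x) ≤ 0)
    {cA θA : ℝ} (hθA : θA < 2)
    (hA : ∀ L : ℝ, 1 ≤ L → ∫ x in closedBall (0 : EuclideanSpace ℝ (Fin 3)) L, ‖U x‖ ^ 2 ≤ cA * L ^ θA)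
    {R r : ℝ} (hr : 0 < r) (hrR : r ≤ R)
    (hfin : volume ({x : EuclideanSpace ℝ (Fin 3) | ω x ≠ 0} ∩ {x | R * (R - r) ≤ ‖x‖ ^ 2}) < ∞) :
    -(3 * γ * (volume ({x : EuclideanSpace ℝ (Fin 3) | ω x ≠ 0} ∩ {x | R * (R - r) ≤ ‖x‖ ^ 2})).toReal) ≤
      ∫ x, ω x * -(fderiv ℝ (taoCutoff R r) x (selfSimilarTransport γ 0 U x)) := by
  obtain ⟨M, hM0, hM⟩ := exists_abs_deriv_smoothTransition_le
  have hM0' : 0 ≤ M := (abs_nonneg _).trans (hM 0)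
  set W : EuclideanSpace ℝ (Fin 3) → EuclideanSpace ℝ (Fin 3) := selfSimilarTransport γ 0 U with hWdef
  set S : Set (EuclideanSpace ℝ (Fin 3)) := {x | ω x ≠ 0} ∩ {x | R * (R - r) ≤ ‖x‖ ^ 2} with hSdef
  set v : ℝ := (volume S).toReal with hvdef
  set F₁ : ℝ := ∫ x, ω x * -(fderiv ℝ (taoCutoff R r) x (W x)) with hF₁
  have hR : 0 < R := hr.trans_le hrR
  have hUc : Continuous U := hprof.contDiff_velocity.continuous
  have hωc : Continuous ω := hω.continuous
  have hSm : MeasurableSet S :=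
    (isOpen_ne_fun hωc continuous_const).measurableSet.inter (isClosed_le continuous_const (continuous_norm.pow 2)).measurableSet
  -- the vanishing error
  set vn : ℕ → ℝ := fun n => (volume (S ∩ {x : EuclideanSpace ℝ (Fin 3) | (n : ℝ) ^ 2 / 2 ≤ ‖x‖ ^ 2})).toReal with hvn
  set ε : ℕ → ℝ := fun n => 4 * M * (vn n / 2 + γ ^ 2 * vn n + cA * (n : ℝ) ^ (θA - 2)) with hεdef
  have hvn0 : Tendsto vn atTop (𝓝 0) := tendsto_volume_inter_far_zero hSm hfin
  have hpow : Tendsto (fun n : ℕ => (n : ℝ) ^ (θA - 2)) atTop (𝓝 0) := by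
    have h := (tendsto_rpow_neg_atTop (by linarith : 0 < 2 - θA)).comp tendsto_natCast_atTop_atTop
    refine h.congr fun n => ?_
    simp only [Function.comp, neg_sub]
  have hε : Tendsto ε atTop (𝓝 0) := by
    have h := ((hvn0.div_const 2).add (hvn0.const_mul (γ ^ 2))).add (hpow.const_mul cA)
    have h' := h.const_mul (4 * M)
    simp only [zero_div, mul_zero, add_zero] at h'
    exact h'
  -- the inequality for every large `n`
  have hstep : ∀ n : ℕ, 2 * R ≤ (n : ℝ) → 1 ≤ (n : ℝ) → -F₁ - 3 * γ * v ≤ ε n := by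
    intro n hn2 hn1
    have hn : (0 : ℝ) < n := by linarith
    have hr₂ : (0 : ℝ) < n / 2 := by linarith
    have hr₂R : (n : ℝ) / 2 ≤ n := by linarith
    have hnest : R ≤ (n : ℝ) - n / 2 := by linarith
    -- exit law
    have hexit := flux_exit_law hprof hω hanti hr hrR hr₂ hr₂R hnest
    have hmass := integral_mul_sub_taoCutoff_le hωc hω0 hω1 hr hrR hr₂ hr₂R hfin
    -- outer flux
    have hout := abs_flux_le (γ := γ) hωc hω0 hω1 hUc hr₂ hr₂R hM
    set An : Set (EuclideanSpace ℝ (Fin 3)) := {x | (n : ℝ) * (n - n / 2) ≤ ‖x‖ ^ 2 ∧ ‖x‖ ≤ n} ∩ {x | ω x ≠ 0} with hAn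
    have hAnsub : An ⊆ S ∩ {x : EuclideanSpace ℝ (Fin 3) | (n : ℝ) ^ 2 / 2 ≤ ‖x‖ ^ 2} := by
      intro x hx
      have h1 : (n : ℝ) ^ 2 / 2 ≤ ‖x‖ ^ 2 := by have := hx.1.1; nlinarith
      refine ⟨⟨hx.2, ?_⟩, h1⟩
      show R * (R - r) ≤ ‖x‖ ^ 2
      nlinarith
    have hTfin : volume (S ∩ {x : EuclideanSpace ℝ (Fin 3) | (n : ℝ) ^ 2 / 2 ≤ ‖x‖ ^ 2}) ≠ ∞ :=
      ((measure_mono inter_subset_left).trans_lt hfin).ne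
    have hvAn : (volume An).toReal ≤ vn n := ENNReal.toReal_mono hTfin (measure_mono hAnsub)
    have hIU : (∫ x in closedBall (0 : EuclideanSpace ℝ (Fin 3)) n, ‖U x‖ ^ 2) ≤ cA * (n : ℝ) ^ θA := hA n hn1
    have hvAn0 : 0 ≤ (volume An).toReal := ENNReal.toReal_nonneg
    have hout' : |∫ x, ω x * -(fderiv ℝ (taoCutoff n (n / 2)) x (W x))| ≤ ε n := by
      refine hout.trans ?_
      have hcoef : 2 * M / ((n : ℝ) / 2 * n) = 4 * M / (n : ℝ) ^ 2 := by field_simp; ring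
      rw [hcoef]
      have hpow' : (n : ℝ) ^ (θA - 2) = (n : ℝ) ^ θA / (n : ℝ) ^ 2 := by
        rw [Real.rpow_sub hn, Real.rpow_two]
      have hn2' : (0 : ℝ) < (n : ℝ) ^ 2 := by positivity
      rw [hεdef]
      simp only
      rw [hpow', div_mul_eq_mul_div, div_le_iff₀ hn2']
      have h1 : (n : ℝ) ^ 2 / 2 * (volume An).toReal ≤ (n : ℝ) ^ 2 / 2 * vn n :=
        mul_le_mul_of_nonneg_left hvAn (by positivity)
      have h2 : γ ^ 2 * (n : ℝ) ^ 2 * (volume An).toReal ≤ γ ^ 2 * (n : ℝ) ^ 2 * vn n :=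
        mul_le_mul_of_nonneg_left hvAn (by positivity)
      have h3 : 4 * M * (vn n / 2 + γ ^ 2 * vn n + cA * ((n : ℝ) ^ θA / (n : ℝ) ^ 2)) * (n : ℝ) ^ 2 =
          4 * M * ((n : ℝ) ^ 2 / 2 * vn n + γ ^ 2 * (n : ℝ) ^ 2 * vn n + cA * (n : ℝ) ^ θA) := by
        field_simp
      rw [h3]
      exact mul_le_mul_of_nonneg_left (by linarith) (by positivity)
    have habs := neg_abs_le (∫ x, ω x * -(fderiv ℝ (taoCutoff n (n / 2)) x (W x)))
    have hγv : 3 * γ * (∫ x, ω x * (taoCutoff (↑n) (↑n / 2) x - taoCutoff R r x)) ≤ 3 * γ * v :=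
      mul_le_mul_of_nonneg_left hmass (by positivity)
    linarith
  have hev : ∀ᶠ n : ℕ in atTop, -F₁ - 3 * γ * v ≤ ε n := by
    filter_upwards [eventually_ge_atTop (max ⌈2 * R⌉₊ 1)] with n hn
    have hn1 : 1 ≤ n := (le_max_right _ _).trans hn
    have hn2 : ⌈2 * R⌉₊ ≤ n := (le_max_left _ _).trans hn
    exact hstep n ((Nat.le_ceil _).trans (Nat.cast_le.2 hn2)) (by exact_mod_cast hn1)
  have hfinal : -F₁ - 3 * γ * v ≤ 0 := ge_of_tendsto hε hev
  linarith

end Turning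

/-! ### The instance `ω = S((ℋ − h)/η)`: Bernoulli high sets -/

section Bernoulli

variable {γ : ℝ} {U : EuclideanSpace ℝ (Fin 3) → EuclideanSpace ℝ (Fin 3)} {P : EuclideanSpace ℝ (Fin 3) → ℝ}

/-- The smoothed indicator `ω = S((ℋ_P − h)/η)` of the Bernoulli high set is `C¹`. [cite: ConstantinIgnatovaVicol2026Putative, §3.4.3 eq. (3.30)] -/
theorem contDiff_bernoulliWeight (hprof : IsSelfSimilarEulerProfile γ 0 U P) (h : ℝ) {η : ℝ} :
    ContDiff ℝ 1 fun x => Real.smoothTransition ((selfSimilarBernoulli γ 0 U P x - h) / η) :=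
  (Real.smoothTransition.contDiff (n := 1)).comp ((hprof.contDiff_selfSimilarBernoulli.sub contDiff_const).div_const η)

/-- The smoothed indicator is non-increasing along `W` for `γ ≤ ½`, `η > 0`:
`D(S((ℋ−h)/η))[W] = S′ · Dℋ[W]/η ≤ 0` (CIV (3.33): `W·∇ℋ = (2γ−1)|W|² ≤ 0`). [cite: ConstantinIgnatovaVicol2026Putative, §3.4.3 eq. (3.33)] -/
theorem fderiv_bernoulliWeight_transport_nonpos (hprof : IsSelfSimilarEulerProfile γ 0 U P) (hγ : γ ≤ 1 / 2) (h : ℝ) {η : ℝ}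
    (hη : 0 < η) (x : EuclideanSpace ℝ (Fin 3)) :
    fderiv ℝ (fun x => Real.smoothTransition ((selfSimilarBernoulli γ 0 U P x - h) / η)) x (selfSimilarTransport γ 0 U x) ≤ 0 := by
  set H : EuclideanSpace ℝ (Fin 3) → ℝ := selfSimilarBernoulli γ 0 U P with hHdef
  have hH1 : ContDiff ℝ 1 H := hprof.contDiff_selfSimilarBernoulli
  have hg : HasFDerivAt (fun x => (H x - h) / η) (η⁻¹ • fderiv ℝ H x) x := by
    have h1 : HasFDerivAt (fun x => H x - h) (fderiv ℝ H x) x := ((hH1.differentiable one_ne_zero) x).hasFDerivAt.sub_const h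
    have h2 := h1.const_mul η⁻¹
    refine (h2.congr_fderiv rfl).congr_of_eventuallyEq (Eventually.of_forall fun y => ?_)
    show (H y - h) / η = η⁻¹ * (H y - h)
    rw [div_eq_inv_mul]
  have hS : HasDerivAt Real.smoothTransition (deriv Real.smoothTransition ((H x - h) / η)) ((H x - h) / η) :=
    ((Real.smoothTransition.contDiff (n := 1)).differentiable one_ne_zero _).hasDerivAt
  have hcomp : HasFDerivAt (fun x => Real.smoothTransition ((H x - h) / η))
      (deriv Real.smoothTransition ((H x - h) / η) • η⁻¹ • fderiv ℝ H x) x := by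
    have := hS.comp_hasFDerivAt x hg
    exact this
  rw [hcomp.fderiv]
  simp only [_root_.smul_apply, smul_eq_mul]
  have hD : fderiv ℝ H x (selfSimilarTransport γ 0 U x) ≤ 0 := hprof.fderiv_selfSimilarBernoulli_transport_nonpos hγ x
  have hS0 : 0 ≤ deriv Real.smoothTransition ((H x - h) / η) := Real.smoothTransition.monotone.deriv_nonneg
  exact mul_nonpos_of_nonneg_of_nonpos hS0 (mul_nonpos_of_nonneg_of_nonpos (inv_nonneg.2 hη.le) hD)

/-- Where the smoothed indicator is non-zero the Bernoulli function exceeds the level: `{S((ℋ−h)/η) ≠ 0} ⊆ {h < ℋ}` (`η > 0`). [folklore] -/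
theorem bernoulliWeight_ne_zero_subset (h : ℝ) {η : ℝ} (hη : 0 < η) :
    {x : EuclideanSpace ℝ (Fin 3) | Real.smoothTransition ((selfSimilarBernoulli γ 0 U P x - h) / η) ≠ 0} ⊆
      {x | h < selfSimilarBernoulli γ 0 U P x} := by
  intro x hx
  simp only [mem_setOf_eq] at hx ⊢
  by_contra hle
  exact hx (Real.smoothTransition.zero_of_nonpos (div_nonpos_of_nonpos_of_nonneg (by linarith [not_lt.1 hle]) hη.le))

/-- On the strict high set `{ℋ ≥ h + η}` the smoothed indicator equals `1`. [folklore] -/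
theorem bernoulliWeight_eq_one {h η : ℝ} (hη : 0 < η) {x : EuclideanSpace ℝ (Fin 3)}
    (hx : h + η ≤ selfSimilarBernoulli γ 0 U P x) :
    Real.smoothTransition ((selfSimilarBernoulli γ 0 U P x - h) / η) = 1 :=
  Real.smoothTransition.one_of_one_le ((one_le_div hη).2 (by linarith))

/-- The flux integrand in kernel form: `ω · (−Dθ_{R,r}[W]) = ω · k · ⟪x, W⟫` with `k = (2/(rR)) S′((R² − |x|²)/(rR)) ≥ 0` — the sign of the
contribution of a point is the sign of `⟪x, W x⟫ = (γ − s)|x|²`, `s` the similarity inflow rate: INFLOW points count negatively. [folklore] -/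
theorem flux_integrand_eq (ω : EuclideanSpace ℝ (Fin 3) → ℝ) (R r : ℝ) (x : EuclideanSpace ℝ (Fin 3)) :
    ω x * -(fderiv ℝ (taoCutoff R r) x (selfSimilarTransport γ 0 U x)) =
      ω x * ((2 / (r * R)) * deriv Real.smoothTransition ((R ^ 2 - ‖x‖ ^ 2) / (r * R))) *
        ⟪x, selfSimilarTransport γ 0 U x⟫ := by
  rw [fderiv_taoCutoff_apply]; ring

/-- **THE TURNING LAW ON BERNOULLI HIGH SETS.**  Let `(U, P)` be a `C²` self-similar Euler profile on `ℝ³` (centre `0`, `0 ≤ γ ≤ ½`) with the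
`A`-growth `∫_{B̄_L} ‖U‖² ≤ c_A L^{θ_A}` (`L ≥ 1`, `θ_A < 2`), `h` a level whose far high set `{ℋ_P > h} ∩ {R(R−r) ≤ |x|²}` has finite volume
(`0 < r ≤ R`), `η > 0`, `ω = S((ℋ_P − h)/η)` (`= 1` on `{ℋ ≥ h+η}`, `= 0` off `{ℋ > h}`).  Then

  `∫ ω k ⟪x, W⟫ dx ≥ −3γ · vol({ℋ_P > h} ∩ {R(R−r) ≤ |x|²})`,  `k = (2/(rR)) S′((R²−|x|²)/(rR)) ≥ 0` the layer density:

the INFLOW flux of the (smoothed) high set through the sphere layer `R(R−r) ≤ |x|² ≤ R²` (fast channel points `⟪x, W⟫ ≤ −c₁|x|²`) is matched by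
OUTFLOW flux of HIGH points (`s < γ`: tangential, pressurised or radially outgoing) up to `3γ·vol(high ∩ far)` — for class profiles
`≤ C r^{−3−3ρ}` by the growth-free Sobolev thinness of the high sets. [folklore; ConstantinIgnatovaVicol2026Putative §3.4.1 (3.22), §3.4.3 (3.33)] -/
theorem bernoulli_flux_turning_law (hprof : IsSelfSimilarEulerProfile γ 0 U P) (hγ0 : 0 ≤ γ) (hγ : γ ≤ 1 / 2)
    {cA θA : ℝ} (hθA : θA < 2)
    (hA : ∀ L : ℝ, 1 ≤ L → ∫ x in closedBall (0 : EuclideanSpace ℝ (Fin 3)) L, ‖U x‖ ^ 2 ≤ cA * L ^ θA)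
    (h : ℝ) {η : ℝ} (hη : 0 < η) {R r : ℝ} (hr : 0 < r) (hrR : r ≤ R)
    (hfin : volume ({x : EuclideanSpace ℝ (Fin 3) | h < selfSimilarBernoulli γ 0 U P x} ∩ {x | R * (R - r) ≤ ‖x‖ ^ 2}) < ∞) :
    -(3 * γ * (volume ({x : EuclideanSpace ℝ (Fin 3) | h < selfSimilarBernoulli γ 0 U P x} ∩ {x | R * (R - r) ≤ ‖x‖ ^ 2})).toReal) ≤
      ∫ x, Real.smoothTransition ((selfSimilarBernoulli γ 0 U P x - h) / η) *
        -(fderiv ℝ (taoCutoff R r) x (selfSimilarTransport γ 0 U x)) := by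
  set ω : EuclideanSpace ℝ (Fin 3) → ℝ := fun x => Real.smoothTransition ((selfSimilarBernoulli γ 0 U P x - h) / η) with hωdef
  have hsub : {x : EuclideanSpace ℝ (Fin 3) | ω x ≠ 0} ∩ {x | R * (R - r) ≤ ‖x‖ ^ 2} ⊆
      {x | h < selfSimilarBernoulli γ 0 U P x} ∩ {x | R * (R - r) ≤ ‖x‖ ^ 2} :=
    inter_subset_inter_left _ (bernoulliWeight_ne_zero_subset h hη)
  have hfin' : volume ({x : EuclideanSpace ℝ (Fin 3) | ω x ≠ 0} ∩ {x | R * (R - r) ≤ ‖x‖ ^ 2}) < ∞ :=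
    (measure_mono hsub).trans_lt hfin
  have hlaw := flux_turning_law hprof hγ0 (contDiff_bernoulliWeight hprof h) (fun x => Real.smoothTransition.nonneg _)
    (fun x => Real.smoothTransition.le_one _) (fderiv_bernoulliWeight_transport_nonpos hprof hγ h hη) hθA hA hr hrR hfin'
  have hmono : (volume ({x : EuclideanSpace ℝ (Fin 3) | ω x ≠ 0} ∩ {x | R * (R - r) ≤ ‖x‖ ^ 2})).toReal ≤
      (volume ({x : EuclideanSpace ℝ (Fin 3) | h < selfSimilarBernoulli γ 0 U P x} ∩ {x | R * (R - r) ≤ ‖x‖ ^ 2})).toReal :=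
    ENNReal.toReal_mono hfin.ne (measure_mono hsub)
  have h3 : 3 * γ * (volume ({x : EuclideanSpace ℝ (Fin 3) | ω x ≠ 0} ∩ {x | R * (R - r) ≤ ‖x‖ ^ 2})).toReal ≤
      3 * γ * (volume ({x : EuclideanSpace ℝ (Fin 3) | h < selfSimilarBernoulli γ 0 U P x} ∩ {x | R * (R - r) ≤ ‖x‖ ^ 2})).toReal :=
    mul_le_mul_of_nonneg_left hmono (by positivity)
  linarith

/-! ### Class form of the `A`-growth -/

/-- From the class `A`-datum in gauge form (`∫⁻_{B_L} ‖U‖ₑ² ≤ c_A L^{1−2ρ}` for all `L > 0`, `0 ≤ c_A`) to the real closed-ball growth used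
above: `∫_{B̄_L} ‖U‖² ≤ (2^{1−2ρ} c_A) L^{1−2ρ}` for `L ≥ 1` (`B̄_L ⊆ B_{2L}`). [folklore] -/
theorem setIntegral_closedBall_sq_norm_le_of_gauge {ρ : ℝ} (hU : Continuous U) {cA : ℝ} (hcA : 0 ≤ cA)
    (hA : ∀ L : ℝ, 0 < L → ∫⁻ y in ball (0 : EuclideanSpace ℝ (Fin 3)) L, ‖U y‖ₑ ^ 2 ≤ ENNReal.ofReal (cA * L ^ (1 - 2 * ρ)))
    {L : ℝ} (hL : 1 ≤ L) :
    ∫ x in closedBall (0 : EuclideanSpace ℝ (Fin 3)) L, ‖U x‖ ^ 2 ≤ (2 : ℝ) ^ (1 - 2 * ρ) * cA * L ^ (1 - 2 * ρ) := by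
  have hL0 : 0 < L := one_pos.trans_le hL
  have hcont : Continuous fun x => ‖U x‖ ^ 2 := hU.norm.pow 2
  have hint : IntegrableOn (fun x => ‖U x‖ ^ 2) (ball (0 : EuclideanSpace ℝ (Fin 3)) (2 * L)) :=
    (hcont.continuousOn.integrableOn_compact (isCompact_closedBall (0 : EuclideanSpace ℝ (Fin 3)) (2 * L))).mono_set
      ball_subset_closedBall
  have hsub : closedBall (0 : EuclideanSpace ℝ (Fin 3)) L ⊆ ball 0 (2 * L) :=
    closedBall_subset_ball (by linarith)
  have h1 : (∫ x in closedBall (0 : EuclideanSpace ℝ (Fin 3)) L, ‖U x‖ ^ 2) ≤ ∫ x in ball (0 : EuclideanSpace ℝ (Fin 3)) (2 * L), ‖U x‖ ^ 2 :=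
    setIntegral_mono_set hint (ae_of_all _ fun x => sq_nonneg _) hsub.eventuallyLE
  have h2 : (∫ x in ball (0 : EuclideanSpace ℝ (Fin 3)) (2 * L), ‖U x‖ ^ 2) ≤ cA * (2 * L) ^ (1 - 2 * ρ) := by
    rw [integral_eq_lintegral_of_nonneg_ae (ae_of_all _ fun x => sq_nonneg _) hcont.aestronglyMeasurable.restrict]
    refine ENNReal.toReal_le_of_le_ofReal (by positivity) ?_
    rw [← lintegral_enorm_sq_eq_lintegral_ofReal]
    exact hA (2 * L) (by positivity)
  have h3 : cA * (2 * L) ^ (1 - 2 * ρ) = (2 : ℝ) ^ (1 - 2 * ρ) * cA * L ^ (1 - 2 * ρ) := by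
    rw [Real.mul_rpow (by norm_num) hL0.le]; ring
  linarith

end Bernoulli




end Summit.NavierStokesRegularity.NavierStokesRegularity.Theorems.PowerGaugeEulerLiouville.HighSetFlux

end
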